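import Literature.NumberTheory.Automorphic.ModularEisensteinFourier
import Literature.NumberTheory.LFunctions.HorocycleRHIncompleteEisenstein
import HarnessLib

/-!
# Incomplete Eisenstein series for `SL₂(ℤ)`: unfolding, constant term, inner products with `1`, cusp forms and `E(·, ½ + ir)`

Layer 27 of the proof of Selberg's lattice-point theorem for the modular group
(`Literature.NumberTheory.Automorphic.sl2BallCount_asymp`): the space `𝓔(Γ\ℍ)` of incomplete
Eisenstein series (Iwaniec §3.2, (3.10)) for `Γ = SL₂(ℤ)`,

  `E(z|ψ) = Σ_{(c,d)=1} ψ(Im γ_{c,d} z)`   (`ψ` continuous, compactly supported in `(0, ∞)`;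
                                           sum over coprime bottom rows = twice the sum over `Γ_∞\Γ̄`),

as functions on `ℍ` (`incEisG`) and as elements of `L²(𝒟)` (`incEisLp`), with

* the bridge `incEis ψ z = E(z|ψ)` to the tree's `Literature.NumberTheory.LFunctions.incEis`
  (Zagier's horocycle files: automorphy is imported from there), local finiteness for continuous
  weights, continuity, boundedness, bounded support in `𝒟`, and the **constant term**
  `∫₀¹ E(x+iy|ψ) dx = 2ψ(y) + 2R_ψ(y)`, `R_ψ(y) = Σ_{c≥1} φ(c) ∫_ℝ ψ(y/(c²(u²+y²))) du`
  (Iwaniec (3.17) with `S(0,0;c) = φ(c)` (2.28); `intervalIntegral_incEisG` from the tree's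
  `horocycleAverage_incEis`);
* the **unfolding** `∫_𝒟 u · E(·|ψ) dμ = 2∫₀^∞ ψ(y) y⁻² (∫₀¹ u(x+iy) dx) dy` for automorphic locally
  integrable `u` (Iwaniec, Lemma 3.3 (3.14); `setIntegral_fd_mul_incEisG`);
* consequences: `∫_𝒟 E(·|ψ) = 2∫ψ y⁻²`, `E(·|ψ) ⊥` Maass cusp forms ((3.14)–(3.15)), the inner
  product of two incomplete Eisenstein series through the constant term (Lemma 3.3 & (3.17)), the
  inner product with an arbitrary `h ∈ L²(𝒟)` through the cusp mean of `h^Γ`, and the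
  **Eisenstein coefficient** (Iwaniec, Lemma before (7.14))
  `⟨E(·|ψ), E(·, ½+ir)⟩ = 2[Mψ(-½-ir) + conj φ(½+ir) · Mψ(-½+ir)]`, `Mψ = mellin ψ`
  (`eisCoeff_eq`), from the constant term `y^{½+ir} + φ y^{½-ir}` of `ModularEisensteinFourier.lean`.

## References

* [Iwaniec2002] H. Iwaniec, *Spectral Methods of Automorphic Forms*, 2nd ed., AMS GSM 53 (2002),
  §3.2 (3.10), Lemma 3.3 (3.14)–(3.15), PDF pp. 42–44; §3.4 (3.17) with (2.28), PDF p. 46; §7.3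
  (the formula for `⟨E_𝔞(·|ψ), E_𝔟(·, s)⟩` before (7.14)), PDF p. 99.
-/

noncomputable section

open MeasureTheory Set Filter Real UpperHalfPlane
open scoped Topology MatrixGroups ComplexConjugate NNReal ENNReal Modular

namespace Literature.NumberTheory.Automorphic

local notation "Γℤ" => (𝒮ℒ : Subgroup (GL (Fin 2) ℝ))
local notation "μ𝒟" => MeasureTheory.Measure.restrict (volume : Measure ℍ) (ModularGroup.fd)

/-! ## Incomplete Eisenstein series `E(z|ψ) = Σ_{(c,d)=1} ψ(Im γ_{c,d} z)` ((3.10)) -/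

section IncEis

open EisensteinSeries ModularGroup
open Literature.NumberTheory.LFunctions (incEis incEisTerm incEis_smul)

/-- **Incomplete Eisenstein series** (Iwaniec (3.10)), summed over coprime bottom rows `(c, d)`,
i.e. twice the sum over `Γ_∞\Γ̄`: `E(z|ψ) = Σ_{(c,d)=1} ψ(Im γ_{c,d} z) = Σ_{(c,d)=1} ψ(1/Q_z(c,d))`.

This is the tree's `Literature.NumberTheory.LFunctions.incEis` of the horocycle files (Zagier's
`E(z|ψ)`), term by term (`incEis_coe` below), but written as a real-valued function on `ℍ` through the
coset representatives `rowRep v ∈ SL₂(ℤ)` — the shape `Σ_v Ψ(rowRep v • w)` required by the unfolding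
lemma `setIntegral_fd_mul_tsum_coset` of `EisensteinOrthogonality.lean`. Automorphy is imported from
`incEis_smul`; the local-finiteness statements below are re-proved because they are needed for merely
continuous weights on the boxes `verticalStrip A B ∩ {Im ≤ Y}` (the horocycle files assume `ψ ∈ C^∞`
for continuity and work on `ℂ`). [cite: Iwaniec2002, (3.10), PDF p. 42] -/
def incEisG (ψ : ℝ → ℝ) (z : ℍ) : ℝ := ∑' v : gammaSet 1 1 0, ψ ((rowRep v • z).im)

/-- `Im(γ_v z) = Im z / |cz + d|²` for the coset representative with bottom row `v = (c, d)`. [folklore] -/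
theorem im_rowRep_smul_eq (z : ℍ) (v : gammaSet 1 1 0) :
    (rowRep v • z).im = z.im / Complex.normSq ((((v : Fin 2 → ℤ) 0 : ℤ) : ℂ) * z + (((v : Fin 2 → ℤ) 1 : ℤ) : ℂ)) := by
  rw [show (rowRep v • z).im = (qForm z v)⁻¹ by rw [qForm_eq_inv_im, inv_inv], qForm, Complex.normSq_eq_norm_sq, inv_div]

/-- **The tree's (doubled) incomplete Eisenstein series `incEis` of the horocycle files is `E(·|ψ)`.**
[cite: Iwaniec2002, (3.10), PDF p. 42] -/
theorem incEis_coe (ψ : ℝ → ℝ) (z : ℍ) : incEis ψ (z : ℂ) = ((incEisG ψ z : ℝ) : ℂ) := by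
  unfold incEis incEisG
  congr 1
  refine tsum_congr fun v => ?_
  rw [incEisTerm, im_rowRep_smul_eq, UpperHalfPlane.coe_im]

/-- **Automorphy** `E(γz|ψ) = E(z|ψ)` for `γ ∈ SL₂(ℤ)` (from `incEis_smul`). [cite: Iwaniec2002, §3.2 (after (3.11)), PDF p. 43] -/
theorem incEisG_smul (ψ : ℝ → ℝ) (γ : SL(2, ℤ)) (z : ℍ) : incEisG ψ (γ • z) = incEisG ψ z := by
  have h := incEis_smul ψ γ z
  rw [incEis_coe, incEis_coe] at h
  exact_mod_cast h

/-- Automorphy under the image `𝒮ℒ` of `SL₂(ℤ)` in `GL₂(ℝ)`. [folklore] -/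
theorem isAutomorphic_incEisG (ψ : ℝ → ℝ) :
    IsAutomorphic (𝒮ℒ : Subgroup (GL (Fin 2) ℝ)) (fun z => ((incEisG ψ z : ℝ) : ℂ)) := by
  rintro γ ⟨g, rfl⟩ z
  simp only
  rw [show (Matrix.SpecialLinearGroup.mapGL ℝ g : GL (Fin 2) ℝ) • z = g • z from rfl, incEisG_smul]

/-- Weights: continuous functions supported in a compact subinterval `[a, b] ⊂ (0, ∞)`. [folklore] -/
structure IsBumpWeight (ψ : ℝ → ℝ) : Prop where
  continuous : Continuous ψ
  support : ∃ a b : ℝ, 0 < a ∧ ∀ y, ψ y ≠ 0 → a ≤ y ∧ y ≤ b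

variable {ψ : ℝ → ℝ}

/-- A bump weight is bounded. [folklore] -/
theorem IsBumpWeight.bounded (hψ : IsBumpWeight ψ) : ∃ B, 0 ≤ B ∧ ∀ y, |ψ y| ≤ B := by
  obtain ⟨a, b, ha, hsupp⟩ := hψ.support
  obtain ⟨B, hB⟩ := isCompact_Icc.exists_bound_of_continuousOn (s := Icc a b) hψ.continuous.continuousOn
  refine ⟨max B 0, le_max_right _ _, fun y => ?_⟩
  by_cases hy : ψ y = 0
  · rw [hy, abs_zero]; exact le_max_right _ _
  · exact ((Real.norm_eq_abs _).symm.le.trans (hB y (hsupp y hy))).trans (le_max_left _ _)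

/-- `Im(γ_v z) = 1/Q_z(v) ≤ Im z / (r(z)² ‖v‖²)`. [folklore] -/
theorem im_rowRep_smul_le (z : ℍ) (v : gammaSet 1 1 0) :
    (rowRep v • z).im ≤ z.im / (EisensteinSeries.r z ^ 2 * ‖(v : Fin 2 → ℤ)‖ ^ 2) := by
  have hv0 : (v : Fin 2 → ℤ) ≠ 0 := by
    intro h
    have := (EisensteinSeries.mem_gammaSet_one v).mp v.2
    rw [h] at this
    exact not_isCoprime_zero_zero (by simpa using this)
  have hq := qForm_ge z v
  have hr := EisensteinSeries.r_pos z
  have hn : (1 : ℝ) ≤ ‖(v : Fin 2 → ℤ)‖ := one_le_norm_of_ne_zero hv0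
  have hy := z.im_pos
  have hpos : 0 < EisensteinSeries.r z ^ 2 * ‖(v : Fin 2 → ℤ)‖ ^ 2 / z.im :=
    div_pos (mul_pos (pow_pos hr 2) (pow_pos (by linarith) 2)) hy
  rw [show (rowRep v • z).im = (qForm z v)⁻¹ by rw [qForm_eq_inv_im, inv_inv]]
  calc (qForm z (v : Fin 2 → ℤ))⁻¹ ≤ (EisensteinSeries.r z ^ 2 * ‖(v : Fin 2 → ℤ)‖ ^ 2 / z.im)⁻¹ := inv_anti₀ hpos hq
    _ = z.im / (EisensteinSeries.r z ^ 2 * ‖(v : Fin 2 → ℤ)‖ ^ 2) := inv_div _ _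

/-- **Local finiteness**: on `{|Re z| ≤ A, B ≤ Im z ≤ Y}` only finitely many terms of `E(z|ψ)` can be
non-zero when `ψ` vanishes below height `a > 0`. [folklore] -/
theorem exists_finset_im_rowRep_lt {A B Y a : ℝ} (hB : 0 < B) (ha : 0 < a) :
    ∃ S : Finset (gammaSet 1 1 0), ∀ z : ℍ, z ∈ verticalStrip A B → z.im ≤ Y →
      ∀ v : gammaSet 1 1 0, v ∉ S → (rowRep v • z).im < a := by
  set r₀ := EisensteinSeries.r ⟨⟨A, B⟩, hB⟩ with hr₀
  have hr₀pos : 0 < r₀ := EisensteinSeries.r_pos _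
  -- `‖v‖² ≤ Y/(a r₀²)` forces `v` into a finite box
  set N : ℤ := ⌈Real.sqrt (max Y 0 / (a * r₀ ^ 2))⌉ with hN
  set box : Set (Fin 2 → ℤ) := Set.Icc (fun _ => -N) (fun _ => N) with hbox
  have hboxfin : box.Finite := Set.finite_Icc _ _
  have hfin : {v : gammaSet 1 1 0 | (v : Fin 2 → ℤ) ∈ box}.Finite :=
    hboxfin.preimage (Subtype.val_injective.injOn)
  refine ⟨hfin.toFinset, fun z hz hzY v hv => ?_⟩
  rw [Set.Finite.mem_toFinset, mem_setOf_eq] at hv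
  by_contra hlt
  push Not at hlt
  apply hv
  -- from `a ≤ Im(γ_v z)`: `‖v‖² ≤ Y/(a r₀²)`
  have hrz : r₀ ≤ EisensteinSeries.r z := EisensteinSeries.r_lower_bound_on_verticalStrip (z := z) hB hz
  have hle := im_rowRep_smul_le z v
  have hv0 : (v : Fin 2 → ℤ) ≠ 0 := by
    intro h
    have := (EisensteinSeries.mem_gammaSet_one v).mp v.2
    rw [h] at this
    exact not_isCoprime_zero_zero (by simpa using this)
  have hn1 : (1 : ℝ) ≤ ‖(v : Fin 2 → ℤ)‖ := one_le_norm_of_ne_zero hv0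
  have hY0 : 0 < z.im := z.im_pos
  have hnorm_sq : ‖(v : Fin 2 → ℤ)‖ ^ 2 ≤ max Y 0 / (a * r₀ ^ 2) := by
    have h1 : a ≤ z.im / (EisensteinSeries.r z ^ 2 * ‖(v : Fin 2 → ℤ)‖ ^ 2) := hlt.trans hle
    have hpos : 0 < EisensteinSeries.r z ^ 2 * ‖(v : Fin 2 → ℤ)‖ ^ 2 :=
      mul_pos (pow_pos (EisensteinSeries.r_pos z) 2) (pow_pos (by linarith) 2)
    rw [le_div_iff₀ hpos] at h1
    rw [le_div_iff₀ (by positivity)]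
    have : r₀ ^ 2 * ‖(v : Fin 2 → ℤ)‖ ^ 2 ≤ EisensteinSeries.r z ^ 2 * ‖(v : Fin 2 → ℤ)‖ ^ 2 :=
      mul_le_mul_of_nonneg_right (pow_le_pow_left₀ hr₀pos.le hrz 2) (by positivity)
    nlinarith [le_max_left Y 0]
  have hnorm : ‖(v : Fin 2 → ℤ)‖ ≤ N := by
    have h1 : ‖(v : Fin 2 → ℤ)‖ ≤ Real.sqrt (max Y 0 / (a * r₀ ^ 2)) := by
      rw [← Real.sqrt_sq (norm_nonneg _)]
      exact Real.sqrt_le_sqrt hnorm_sq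
    exact h1.trans (Int.le_ceil _)
  simp only [hbox, Set.mem_Icc]
  constructor <;> intro i
  · have := (norm_le_pi_norm (v : Fin 2 → ℤ) i)
    rw [Int.norm_eq_abs] at this
    have h2 : |((v : Fin 2 → ℤ) i : ℝ)| ≤ N := this.trans hnorm
    have h3 : (-(N : ℝ)) ≤ ((v : Fin 2 → ℤ) i : ℝ) := by linarith [neg_abs_le (((v : Fin 2 → ℤ) i : ℝ))]
    exact_mod_cast h3
  · have := (norm_le_pi_norm (v : Fin 2 → ℤ) i)
    rw [Int.norm_eq_abs] at this
    have h2 : |((v : Fin 2 → ℤ) i : ℝ)| ≤ N := this.trans hnorm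
    have h3 : ((v : Fin 2 → ℤ) i : ℝ) ≤ N := (le_abs_self _).trans h2
    exact_mod_cast h3

/-- On `{|Re z| ≤ A, B ≤ Im z ≤ Y}` the series `E(z|ψ)` is a finite sum. [folklore] -/
theorem IsBumpWeight.exists_finset_eq_sum (hψ : IsBumpWeight ψ) {A B Y : ℝ} (hB : 0 < B) :
    ∃ S : Finset (gammaSet 1 1 0), ∀ z : ℍ, z ∈ verticalStrip A B → z.im ≤ Y →
      (∀ v : gammaSet 1 1 0, v ∉ S → ψ ((rowRep v • z).im) = 0) ∧
        incEisG ψ z = ∑ v ∈ S, ψ ((rowRep v • z).im) := by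
  obtain ⟨a, b, ha, hsupp⟩ := hψ.support
  obtain ⟨S, hS⟩ := exists_finset_im_rowRep_lt (A := A) (Y := Y) hB ha
  refine ⟨S, fun z hz hzY => ?_⟩
  have hzero : ∀ v : gammaSet 1 1 0, v ∉ S → ψ ((rowRep v • z).im) = 0 := by
    intro v hv
    by_contra h
    exact absurd (hsupp _ h).1 (not_le.mpr (hS z hz hzY v hv))
  exact ⟨hzero, tsum_eq_sum fun v hv => hzero v hv⟩

/-- The terms are summable (finitely many are non-zero). [folklore] -/
theorem IsBumpWeight.summable (hψ : IsBumpWeight ψ) (z : ℍ) :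
    Summable fun v : gammaSet 1 1 0 => ψ ((rowRep v • z).im) := by
  have hB : 0 < z.im / 2 := by have := z.im_pos; positivity
  obtain ⟨S, hS⟩ := hψ.exists_finset_eq_sum (A := |z.re|) (Y := z.im) hB
  have hz : z ∈ verticalStrip |z.re| (z.im / 2) := ⟨le_rfl, by have := z.im_pos; linarith⟩
  exact summable_of_ne_finset_zero (s := S) fun v hv => (hS z hz le_rfl).1 v hv

/-- The terms are absolutely summable, in the complexified form used by the unfolding lemmas. [folklore] -/
theorem IsBumpWeight.summable_norm (hψ : IsBumpWeight ψ) (z : ℍ) :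
    Summable fun v : gammaSet 1 1 0 => ‖((ψ ((rowRep v • z).im) : ℝ) : ℂ)‖ := by
  have hB : 0 < z.im / 2 := by have := z.im_pos; positivity
  obtain ⟨S, hS⟩ := hψ.exists_finset_eq_sum (A := |z.re|) (Y := z.im) hB
  have hz : z ∈ verticalStrip |z.re| (z.im / 2) := ⟨le_rfl, by have := z.im_pos; linarith⟩
  refine summable_of_ne_finset_zero (s := S) fun v hv => ?_
  rw [(hS z hz le_rfl).1 v hv]; simp

/-- **Continuity of `E(·|ψ)`** (locally a finite sum of continuous functions). [folklore] -/
theorem IsBumpWeight.continuous_incEisG (hψ : IsBumpWeight ψ) : Continuous (incEisG ψ) := by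
  rw [continuous_iff_continuousAt]
  intro z₀
  have hB : 0 < z₀.im / 2 := by have := z₀.im_pos; positivity
  set U : Set ℍ := {z : ℍ | |z.re| < |z₀.re| + 1 ∧ z₀.im / 2 < z.im ∧ z.im < 2 * z₀.im} with hU
  have hUopen : IsOpen U := by
    refine (isOpen_lt (continuous_abs.comp UpperHalfPlane.continuous_re) continuous_const).inter
      ((isOpen_lt continuous_const UpperHalfPlane.continuous_im).inter
        (isOpen_lt UpperHalfPlane.continuous_im continuous_const))
  have hz₀U : z₀ ∈ U := ⟨by linarith [abs_nonneg z₀.re], by have := z₀.im_pos; linarith, by have := z₀.im_pos; linarith⟩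
  obtain ⟨S, hS⟩ := hψ.exists_finset_eq_sum (A := |z₀.re| + 1) (Y := 2 * z₀.im) hB
  have heq : ∀ z ∈ U, incEisG ψ z = ∑ v ∈ S, ψ ((rowRep v • z).im) := fun z hz =>
    (hS z ⟨hz.1.le, hz.2.1.le⟩ hz.2.2.le).2
  have hcont : Continuous fun z : ℍ => ∑ v ∈ S, ψ ((rowRep v • z).im) := by
    refine continuous_finsetSum S fun v _ => hψ.continuous.comp (UpperHalfPlane.continuous_im.comp ?_)
    exact continuous_const_smul (Matrix.SpecialLinearGroup.mapGL ℝ ((rowRep v : SL(2, ℤ)) : SL(2, ℝ)) : GL (Fin 2) ℝ)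
  refine (hcont.continuousAt.congr ?_)
  filter_upwards [hUopen.mem_nhds hz₀U] with z hz
  exact (heq z hz).symm

/-- Terms with `c ≠ 0` live at height `≤ 1/Im z`: `Im(γ_{c,d} z) = y/((cx+d)² + c²y²) ≤ 1/(c²y)`. [folklore] -/
theorem im_rowRep_smul_le_inv (z : ℍ) (v : gammaSet 1 1 0) (hc : (v : Fin 2 → ℤ) 0 ≠ 0) :
    (rowRep v • z).im ≤ (z.im)⁻¹ := by
  have hy := z.im_pos
  have hq : z.im ≤ qForm z v := by
    rw [qForm_apply, le_div_iff₀ hy]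
    have hc1 : (1 : ℝ) ≤ ((v : Fin 2 → ℤ) 0 : ℝ) ^ 2 := by
      have : (1 : ℤ) ≤ ((v : Fin 2 → ℤ) 0) ^ 2 := by
        have h := Int.one_le_abs hc
        nlinarith [sq_abs ((v : Fin 2 → ℤ) 0)]
      exact_mod_cast this
    nlinarith [sq_nonneg (((v : Fin 2 → ℤ) 0 : ℝ) * z.re + (v : Fin 2 → ℤ) 1), mul_pos hy hy]
  rw [show (rowRep v • z).im = (qForm z v)⁻¹ by rw [qForm_eq_inv_im, inv_inv]]
  exact inv_anti₀ hy hq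

/-- The coset of the identity: bottom row `(0, 1)`. [folklore] -/
def rowPlus : gammaSet 1 1 0 := ⟨![0, 1], (EisensteinSeries.mem_gammaSet_one _).mpr (by simpa using isCoprime_one_right)⟩

/-- The coset of `-1`: bottom row `(0, -1)`. [folklore] -/
def rowMinus : gammaSet 1 1 0 := ⟨![0, -1], (EisensteinSeries.mem_gammaSet_one _).mpr (by simpa using isCoprime_one_right.neg_right)⟩

/-- `(0, 1) ≠ (0, -1)`. [folklore] -/
theorem rowPlus_ne_rowMinus : rowPlus ≠ rowMinus := by
  intro h
  have := congrArg (fun v : gammaSet 1 1 0 => (v : Fin 2 → ℤ) 1) h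
  simp [rowPlus, rowMinus] at this

/-- A coprime row with `c = 0` is `±(0, 1)`. [folklore] -/
theorem eq_rowPlus_or_rowMinus (v : gammaSet 1 1 0) (hc : (v : Fin 2 → ℤ) 0 = 0) : v = rowPlus ∨ v = rowMinus := by
  have hcop := (EisensteinSeries.mem_gammaSet_one v).mp v.2
  rw [hc, Int.isCoprime_iff_gcd_eq_one, Int.gcd_zero_left] at hcop
  rcases Int.natAbs_eq_iff.mp hcop with h | h
  · left
    apply Subtype.ext; funext i; fin_cases i
    · simpa [rowPlus] using hc
    · simpa [rowPlus] using h
  · right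
    apply Subtype.ext; funext i; fin_cases i
    · simpa [rowMinus] using hc
    · simpa [rowMinus] using h

/-- `Im(γ_{0,±1} z) = Im z`. [folklore] -/
theorem im_rowRep_smul_of_fst_eq_zero (z : ℍ) (v : gammaSet 1 1 0) (hc : (v : Fin 2 → ℤ) 0 = 0) :
    (rowRep v • z).im = z.im := by
  have hcop := (EisensteinSeries.mem_gammaSet_one v).mp v.2
  rw [hc, Int.isCoprime_iff_gcd_eq_one, Int.gcd_zero_left] at hcop
  have hd : (((v : Fin 2 → ℤ) 1 : ℝ)) ^ 2 = 1 := by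
    have : ((v : Fin 2 → ℤ) 1) ^ 2 = 1 := by
      rcases Int.natAbs_eq_iff.mp hcop with h | h <;> rw [h] <;> norm_num
    exact_mod_cast this
  rw [show (rowRep v • z).im = (qForm z v)⁻¹ by rw [qForm_eq_inv_im, inv_inv], qForm_apply, hc]
  push_cast
  rw [zero_mul, zero_add, hd]
  have := z.im_pos
  field_simp
  ring

/-- **`E(z|ψ)` high in the cusp**: if `ψ` vanishes below height `a` and `Im z > 1/a`, only `±(0,1)`
contribute: `E(z|ψ) = 2ψ(Im z)`. [cite: Iwaniec2002, §3.2 (after (3.11)), PDF p. 43] -/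
theorem incEisG_eq_two_mul {a : ℝ} (ha : 0 < a) (hsupp : ∀ y, ψ y ≠ 0 → a ≤ y) {z : ℍ} (hz : a⁻¹ < z.im) :
    incEisG ψ z = 2 * ψ z.im := by
  classical
  have hzero : ∀ v : gammaSet 1 1 0, v ∉ ({rowPlus, rowMinus} : Finset (gammaSet 1 1 0)) → ψ ((rowRep v • z).im) = 0 := by
    intro v hv
    have hc : (v : Fin 2 → ℤ) 0 ≠ 0 := by
      intro hc
      rcases eq_rowPlus_or_rowMinus v hc with h | h <;> simp [h] at hv
    by_contra hne
    have h1 := hsupp _ hne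
    have h2 := im_rowRep_smul_le_inv z v hc
    have h3 : (z.im)⁻¹ < a := by
      rw [inv_lt_comm₀ z.im_pos ha]; exact hz
    linarith
  unfold incEisG
  rw [tsum_eq_sum (s := {rowPlus, rowMinus}) hzero, Finset.sum_pair rowPlus_ne_rowMinus,
    im_rowRep_smul_of_fst_eq_zero z rowPlus (by simp [rowPlus]), im_rowRep_smul_of_fst_eq_zero z rowMinus (by simp [rowMinus])]
  ring

/-- `𝒟 ⊆ {|Re z| ≤ 1/2, Im z ≥ 1/2}`. [folklore] -/
theorem fd_subset_verticalStrip : ModularGroup.fd ⊆ verticalStrip (1 / 2) (1 / 2) := fun _ hz =>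
  ⟨hz.2, half_le_im_of_mem_fd hz⟩

/-- **`E(·|ψ)` is bounded on `𝒟`**, hence everywhere ("a bounded automorphic function on `ℍ`"). [cite: Iwaniec2002, §3.2 (after (3.11)), PDF p. 43] -/
theorem IsBumpWeight.exists_bound_fd (hψ : IsBumpWeight ψ) : ∃ C, ∀ z ∈ ModularGroup.fd, |incEisG ψ z| ≤ C := by
  obtain ⟨a, b, ha, hsupp⟩ := hψ.support
  obtain ⟨B, hB0, hB⟩ := hψ.bounded
  obtain ⟨S, hS⟩ := hψ.exists_finset_eq_sum (A := 1 / 2) (Y := a⁻¹) (by norm_num : (0 : ℝ) < 1 / 2)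
  refine ⟨max (S.card * B) (2 * B), fun z hz => ?_⟩
  by_cases hzY : z.im ≤ a⁻¹
  · rw [(hS z (fd_subset_verticalStrip hz) hzY).2]
    refine (Finset.abs_sum_le_sum_abs _ _).trans ((Finset.sum_le_card_nsmul _ _ B fun v _ => hB _).trans ?_)
    simp only [nsmul_eq_mul]
    exact le_max_left _ _
  · rw [incEisG_eq_two_mul ha (fun y hy => (hsupp y hy).1) (not_le.mp hzY), abs_mul, abs_two]
    exact (mul_le_mul_of_nonneg_left (hB _) (by norm_num)).trans (le_max_right _ _)

/-- **`E(·|ψ)` is bounded on `ℍ`.** [cite: Iwaniec2002, §3.2 (after (3.11)), PDF p. 43] -/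
theorem IsBumpWeight.exists_bound (hψ : IsBumpWeight ψ) : ∃ C, 0 ≤ C ∧ ∀ z, |incEisG ψ z| ≤ C := by
  obtain ⟨C, hC⟩ := hψ.exists_bound_fd
  refine ⟨max C 0, le_max_right _ _, fun z => ?_⟩
  obtain ⟨γ, ⟨g, rfl⟩, hγz⟩ := modular_fd_covers z
  have h := hC _ hγz
  rw [show (Matrix.SpecialLinearGroup.mapGL ℝ g : GL (Fin 2) ℝ) • z = g • z from rfl, incEisG_smul] at h
  exact h.trans (le_max_left _ _)

/-- **Support of `E(·|ψ)` on `𝒟`** is bounded in height: `E(z|ψ) = 0` for `z ∈ ℍ` with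
`Im z > max(b, 1/a)` when `supp ψ ⊆ [a, b]`. [folklore] -/
theorem incEisG_eq_zero_of_im_gt {a b : ℝ} (ha : 0 < a) (hsupp : ∀ y, ψ y ≠ 0 → a ≤ y ∧ y ≤ b) {z : ℍ}
    (hz : max b a⁻¹ < z.im) : incEisG ψ z = 0 := by
  rw [incEisG_eq_two_mul ha (fun y hy => (hsupp y hy).1) ((le_max_right _ _).trans_lt hz)]
  have : ψ z.im = 0 := by
    by_contra h
    have := (hsupp _ h).2
    linarith [le_max_left b a⁻¹]
  rw [this, mul_zero]

end IncEis

/-! ## The bridge to the horocycle files and the constant term -/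

section ConstantTerm

open EisensteinSeries ModularGroup
open Literature.NumberTheory.LFunctions (incEis rowIntegral horocycleAverage_incEis)

variable {ψ : ℝ → ℝ} {x y : ℝ}

/-- `R_ψ(y) = Σ_{c ≥ 1} φ(c) ∫_ℝ ψ(y/(c²(u² + y²))) du`, the non-trivial part of the constant term of
`E(·|ψ)` (a finite sum for each `y`; `S(0, 0; c) = φ(c)`). [cite: Iwaniec2002, (3.17) & (2.28), PDF p. 46] -/
def eisR (ψ : ℝ → ℝ) (y : ℝ) : ℝ := ∑' c : ℕ, (Nat.totient c : ℝ) * rowIntegral ψ c y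

/-- `pt x y = x + iy` as a complex number. [folklore] -/
theorem coe_pt_eq_add (hy : 0 < y) (x : ℝ) : ((pt x y : ℍ) : ℂ) = (x : ℂ) + (y : ℂ) * Complex.I := by
  rw [coe_pt hy, Complex.mk_eq_add_mul_I]

/-- **Constant term of an incomplete Eisenstein series**: for a bump weight `ψ` and `y > 0`,
`∫₀¹ E(x + iy|ψ) dx = 2ψ(y) + 2R_ψ(y)` (the `c = 0` cosets give `2ψ`; the others unfold to the row
integrals, `S(0,0;c) = φ(c)`). [cite: Iwaniec2002, (3.17) & (2.28), PDF p. 46] -/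
theorem intervalIntegral_incEisG (hψ : IsBumpWeight ψ) (hy : 0 < y) :
    ∫ x in (0 : ℝ)..1, ((incEisG ψ (pt x y) : ℝ) : ℂ) = ((2 * ψ y + 2 * eisR ψ y : ℝ) : ℂ) := by
  obtain ⟨a, b, ha, hsupp⟩ := hψ.support
  have h := horocycleAverage_incEis ha (fun t ht => (hsupp t ht).1) hψ.continuous hy
  have e : ∀ x : ℝ, incEis ψ (↑x + ↑y * Complex.I) = ((incEisG ψ (pt x y) : ℝ) : ℂ) := fun x => by
    rw [← coe_pt_eq_add hy, incEis_coe]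
  simp_rw [e] at h
  exact h

end ConstantTerm

/-! ## Unfolding `∫_𝒟 u E(·|ψ)` -/

section Unfolding

open EisensteinSeries ModularGroup

variable {ψ : ℝ → ℝ}

/-- The box `{0 ≤ Re ≤ 1, a ≤ Im ≤ b}` carries `𝟙_{S'} ψ(Im ·) u` for `supp ψ ⊆ [a, b]`. [folklore] -/
theorem integrable_indicator_stripFD_mul (hψ : IsBumpWeight ψ) {u : ℍ → ℂ} (hul : LocallyIntegrable u) :
    Integrable fun w : ℍ => stripFD.indicator (fun _ => (1 : ℂ)) w * ((ψ w.im : ℝ) : ℂ) * u w := by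
  obtain ⟨a, b, ha, hsupp⟩ := hψ.support
  obtain ⟨B, hB0, hB⟩ := hψ.bounded
  set K : Set ℍ := {w : ℍ | w.re ∈ Icc (0 : ℝ) 1 ∧ w.im ∈ Icc a b} with hK
  have hKc : IsCompact K := isCompact_box ha
  set f : ℍ → ℂ := fun w => stripFD.indicator (fun _ => (1 : ℂ)) w * ((ψ w.im : ℝ) : ℂ) * u w with hf
  have hsupp_f : Function.support f ⊆ K := by
    intro w hw
    rw [Function.mem_support] at hw
    simp only [hf] at hw
    have h1 : w ∈ stripFD := by
      by_contra h; apply hw; rw [Set.indicator_of_notMem h]; simp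
    have h2 : ψ w.im ≠ 0 := by
      intro h; apply hw; rw [h]; simp
    exact ⟨⟨h1.1, h1.2.le⟩, hsupp _ h2⟩
  have hmeas : AEStronglyMeasurable (fun w : ℍ => stripFD.indicator (fun _ => (1 : ℂ)) w * ((ψ w.im : ℝ) : ℂ)) volume := by
    refine (AEStronglyMeasurable.indicator aestronglyMeasurable_const measurableSet_stripFD).mul ?_
    exact (Complex.continuous_ofReal.comp (hψ.continuous.comp UpperHalfPlane.continuous_im)).aestronglyMeasurable
  have hbdd : ∀ w : ℍ, ‖stripFD.indicator (fun _ => (1 : ℂ)) w * ((ψ w.im : ℝ) : ℂ)‖ ≤ B := by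
    intro w
    rw [norm_mul, Complex.norm_real, Real.norm_eq_abs]
    have h1 : ‖stripFD.indicator (fun _ => (1 : ℂ)) w‖ ≤ 1 := by
      by_cases h : w ∈ stripFD
      · rw [Set.indicator_of_mem h, norm_one]
      · rw [Set.indicator_of_notMem h, norm_zero]; exact zero_le_one
    calc ‖stripFD.indicator (fun _ => (1 : ℂ)) w‖ * |ψ w.im| ≤ 1 * B :=
          mul_le_mul h1 (hB _) (abs_nonneg _) zero_le_one
      _ = B := one_mul B
  -- `f = 𝟙_K f` and `f` is integrable on `K`
  have hfK : IntegrableOn f K volume := by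
    have huK : IntegrableOn u K volume := hul.integrableOn_isCompact hKc
    have := huK.integrable.bdd_mul (c := B) hmeas.restrict (Eventually.of_forall hbdd)
    exact this
  have hind : K.indicator f = f := Set.indicator_eq_self.mpr hsupp_f
  rw [← hind]
  exact hfK.integrable_indicator hKc.measurableSet

/-- **Unfolding an incomplete Eisenstein series against an automorphic function** (Iwaniec,
Lemma 3.3 (3.14), here with the factor `2` of the coprime-row convention): for `u` automorphic and
locally integrable and a bump weight `ψ`, `∫_𝒟 u(w) E(w|ψ) dμ(w) = 2 ∫₀^∞ y⁻² ψ(y) (∫₀¹ u(x + iy) dx) dy`.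
[cite: Iwaniec2002, Lemma 3.3 (3.14), PDF p. 44] -/
theorem setIntegral_fd_mul_incEisG (hψ : IsBumpWeight ψ) {u : ℍ → ℂ} (hua : IsAutomorphic Γℤ u)
    (hul : LocallyIntegrable u) :
    ∫ w in ModularGroup.fd, u w * ((incEisG ψ w : ℝ) : ℂ) =
      2 * ∫ y in Ioi (0 : ℝ), (((y ^ 2)⁻¹ * ψ y : ℝ) : ℂ) * ∫ x in Ico (0 : ℝ) 1, u (pt x y) := by
  have hint := integrable_indicator_stripFD_mul hψ hul
  have h1 := setIntegral_fd_mul_tsum_coset (u := u) (Ψ := fun w : ℍ => ((ψ w.im : ℝ) : ℂ)) hua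
    (fun n w => by simp [UpperHalfPlane.vadd_im]) (hψ.summable_norm) hint
  have e : ∀ w : ℍ, ((incEisG ψ w : ℝ) : ℂ) = ∑' v : gammaSet 1 1 0, ((ψ (rowRep v • w).im : ℝ) : ℂ) := by
    intro w; unfold incEisG; rw [Complex.ofReal_tsum]
  simp_rw [e]
  rw [h1]
  congr 1
  have hF : IntegrableOn (fun w : ℍ => ((ψ w.im : ℝ) : ℂ) * u w) stripFD volume := by
    rw [← integrable_indicator_iff measurableSet_stripFD]
    refine hint.congr (Eventually.of_forall fun w => ?_)
    by_cases h : w ∈ stripFD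
    · simp [Set.indicator_of_mem h]
    · simp [Set.indicator_of_notMem h]
  rw [setIntegral_stripFD_eq hF]
  refine setIntegral_congr_fun measurableSet_Ioi fun y hy => ?_
  have hy' : (0 : ℝ) < y := hy
  simp only [pt_im hy']
  rw [integral_const_mul, Complex.real_smul, Complex.ofReal_mul]
  ring

end Unfolding

/-! ## `E(·|ψ)` in `L²(𝒟)` and its inner products -/

section InnerProducts

open EisensteinSeries ModularGroup

variable {ψ ψ₁ ψ₂ : ℝ → ℝ}

attribute [local instance] isFiniteMeasure_restrict_fd

/-- A bump weight gives an `L²(𝒟)` function (bounded on a finite-measure set). [cite: Iwaniec2002, §3.2 (after (3.11)), PDF p. 43] -/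
theorem memLp_incEisG (hψ : IsBumpWeight ψ) : MemLp (fun w : ℍ => ((incEisG ψ w : ℝ) : ℂ)) 2 μ𝒟 := by
  obtain ⟨C, _, hC⟩ := hψ.exists_bound
  refine MemLp.of_bound ((Complex.continuous_ofReal.comp hψ.continuous_incEisG).aestronglyMeasurable) C
    (Eventually.of_forall fun w => ?_)
  rw [Complex.norm_real, Real.norm_eq_abs]; exact hC w

/-- **`E(·|ψ) ∈ L²(𝒟)`** as an element of the Hilbert space ("clearly square integrable over `F`"). [cite: Iwaniec2002, §3.2 (after (3.11)), PDF p. 43] -/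
def incEisLp (hψ : IsBumpWeight ψ) : Lp ℂ 2 μ𝒟 := (memLp_incEisG hψ).toLp _

/-- The `L²` class of `E(·|ψ)` is represented by `E(·|ψ)`. [folklore] -/
theorem incEisLp_coeFn (hψ : IsBumpWeight ψ) : ⇑(incEisLp hψ) =ᵐ[μ𝒟] fun w => ((incEisG ψ w : ℝ) : ℂ) :=
  MemLp.coeFn_toLp _

/-- `E(·|ψ)` is locally integrable on `ℍ` (continuous). [folklore] -/
theorem locallyIntegrable_incEisG (hψ : IsBumpWeight ψ) : LocallyIntegrable fun w : ℍ => ((incEisG ψ w : ℝ) : ℂ) :=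
  (Complex.continuous_ofReal.comp hψ.continuous_incEisG).locallyIntegrable

/-- **`⟨E(·|ψ), 1⟩ = 2∫₀^∞ ψ(y) y⁻² dy`** (Lemma 3.3 with `f = 1`). [cite: Iwaniec2002, Lemma 3.3 (3.14), PDF p. 44] -/
theorem integral_fd_incEisG (hψ : IsBumpWeight ψ) :
    ∫ w in ModularGroup.fd, ((incEisG ψ w : ℝ) : ℂ) = 2 * ∫ y in Ioi (0 : ℝ), (((y ^ 2)⁻¹ * ψ y : ℝ) : ℂ) := by
  have h := setIntegral_fd_mul_incEisG hψ (u := fun _ => (1 : ℂ)) (fun _ _ _ => rfl) (locallyIntegrable_const 1)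
  simp only [one_mul] at h
  rw [h]
  congr 1
  refine setIntegral_congr_fun measurableSet_Ioi fun y _ => ?_
  simp

/-- **`E(·|ψ) ⊥` Maass cusp forms** (the constant term of a cusp form vanishes: Lemma 3.3 and (3.15)).
[cite: Iwaniec2002, (3.14)-(3.15), PDF p. 44] -/
theorem IsMaassCuspForm.integral_fd_conj_mul_incEisG {u : ℍ → ℂ} {t : ℂ} (hu : IsMaassCuspForm u t)
    (hψ : IsBumpWeight ψ) :
    ∫ w in ModularGroup.fd, conj (u w) * ((incEisG ψ w : ℝ) : ℂ) = 0 := by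
  have hua : IsAutomorphic Γℤ (fun w => conj (u w)) := fun γ hγ z => by simp [hu.automorphic γ hγ z]
  have hul : LocallyIntegrable fun w => conj (u w) := (Complex.continuous_conj.comp hu.continuous).locallyIntegrable
  rw [setIntegral_fd_mul_incEisG hψ hua hul]
  have h0 : ∀ y ∈ Ioi (0 : ℝ), ∫ x in Ico (0 : ℝ) 1, conj (u (pt x y)) = 0 := by
    intro y hy
    have hy' : (0 : ℝ) < y := hy
    rw [integral_conj, hu.setIntegral_Ico_eq_zero hy', map_zero]
  rw [setIntegral_congr_fun measurableSet_Ioi (fun y hy => by rw [h0 y hy])]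
  simp

/-- **The inner product of two incomplete Eisenstein series through the constant term**
(Lemma 3.3 with `f = E(·|ψ₁)`, whose zero-th Fourier term is `2ψ₁ + 2R_{ψ₁}` by (3.17)):
`∫_𝒟 E(·|ψ₁) E(·|ψ₂) dμ = 2∫₀^∞ y⁻² ψ₂(y) (2ψ₁(y) + 2R_{ψ₁}(y)) dy`. [cite: Iwaniec2002, Lemma 3.3 (3.14) & (3.17), PDF pp. 44, 46] -/
theorem integral_fd_incEisG_mul_incEisG (hψ₁ : IsBumpWeight ψ₁) (hψ₂ : IsBumpWeight ψ₂) :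
    ∫ w in ModularGroup.fd, ((incEisG ψ₁ w : ℝ) : ℂ) * ((incEisG ψ₂ w : ℝ) : ℂ) =
      2 * ∫ y in Ioi (0 : ℝ), ((((y ^ 2)⁻¹ * ψ₂ y) * (2 * ψ₁ y + 2 * eisR ψ₁ y) : ℝ) : ℂ) := by
  rw [setIntegral_fd_mul_incEisG hψ₂ (isAutomorphic_incEisG ψ₁) (locallyIntegrable_incEisG hψ₁)]
  congr 1
  refine setIntegral_congr_fun measurableSet_Ioi fun y hy => ?_
  have hy' : (0 : ℝ) < y := hy
  rw [integral_Ico_eq_integral_Ioc, ← intervalIntegral.integral_of_le zero_le_one, intervalIntegral_incEisG hψ₁ hy']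
  push_cast
  ring

/-- **`⟨E(·|ψ), h⟩` for `h ∈ L²(𝒟)` through the cusp mean of the automorphic extension `h^Γ`**:
`∫_𝒟 E(·|ψ) h dμ = 2∫₀^∞ y⁻² ψ(y) (∫_{[0,1)} h^Γ(x + iy) dx) dy` — Lemma 3.3, the formula behind
`𝓔(Γ\ℍ)^⊥ = 𝓒(Γ\ℍ)` ((3.15)). [cite: Iwaniec2002, Lemma 3.3 (3.14)-(3.15), PDF p. 44] -/
theorem integral_fd_incEisG_mul_Lp (hψ : IsBumpWeight ψ) (h : Lp ℂ 2 μ𝒟) :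
    ∫ w in ModularGroup.fd, ((incEisG ψ w : ℝ) : ℂ) * h w =
      2 * ∫ y in Ioi (0 : ℝ), (((y ^ 2)⁻¹ * ψ y : ℝ) : ℂ) * ∫ x in Ico (0 : ℝ) 1, autExt Γℤ ModularGroup.fd h (pt x y) := by
  have hΓ := modular_le_range_toGL
  have hneg := neg_one_mem_modular
  have hd := isDiscreteSubgroup_modular
  have hF := isHypFundamentalDomain_modular_fd
  have hae := autExt_ae_eq_restrict hΓ hneg hd hF (⇑h)
  have e1 : ∫ w in ModularGroup.fd, ((incEisG ψ w : ℝ) : ℂ) * h w =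
      ∫ w in ModularGroup.fd, autExt Γℤ ModularGroup.fd h w * ((incEisG ψ w : ℝ) : ℂ) := by
    refine integral_congr_ae ?_
    filter_upwards [hae] with w hw
    rw [hw, mul_comm]
  rw [e1, setIntegral_fd_mul_incEisG hψ (isAutomorphic_autExt _) (locallyIntegrable_autExt hΓ hneg hd hF (Lp.memLp h))]

end InnerProducts

/-! ## The Eisenstein coefficient `⟨E(·|ψ), E(·, ½ + ir)⟩` -/

section EisCoeff

open EisensteinSeries ModularGroup

variable {ψ : ℝ → ℝ}

/-- A bump weight times a function continuous on `(0, ∞)` is integrable on `(0, ∞)`. [folklore] -/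
theorem IsBumpWeight.integrableOn_mul (hψ : IsBumpWeight ψ) {G : ℝ → ℂ} (hG : ContinuousOn G (Ioi 0)) :
    IntegrableOn (fun y => ((ψ y : ℝ) : ℂ) * G y) (Ioi 0) := by
  obtain ⟨a, b, ha, hsupp⟩ := hψ.support
  have hsub : Icc a b ⊆ Ioi 0 := fun y hy => lt_of_lt_of_le ha hy.1
  have hcont : ContinuousOn (fun y => ((ψ y : ℝ) : ℂ) * G y) (Icc a b) :=
    ((Complex.continuous_ofReal.comp hψ.continuous).continuousOn).mul (hG.mono hsub)
  refine (hcont.integrableOn_compact isCompact_Icc).of_forall_sdiff_eq_zero measurableSet_Ioi fun y hy => ?_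
  have : ψ y = 0 := by by_contra h; exact hy.2 (hsupp y h)
  simp [this]

/-- **The Eisenstein coefficient** `ℰ_ψ(r) = ⟨E(·|ψ), E(·, ½ + ir)⟩ = ∫_𝒟 E(w|ψ) conj E(w, ½+ir) dμ(w)`
(the projection coefficient in (7.14)-(7.15)). [cite: Iwaniec2002, (7.14)-(7.15), PDF pp. 99-100] -/
def eisCoeff (ψ : ℝ → ℝ) (r : ℝ) : ℂ :=
  ∫ w in ModularGroup.fd, ((incEisG ψ w : ℝ) : ℂ) * conj (eisensteinCrit w r)

/-- Unfolded: `ℰ_ψ(r) = 2∫₀^∞ y⁻² ψ(y) conj e(y, r) dy` with `e(y, r)` the constant term of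
`E(·, ½ + ir)`. [cite: Iwaniec2002, §7.3 (formula before (7.14)), PDF p. 99] -/
theorem eisCoeff_eq_integral (hψ : IsBumpWeight ψ) (r : ℝ) :
    eisCoeff ψ r = 2 * ∫ y in Ioi (0 : ℝ), (((y ^ 2)⁻¹ * ψ y : ℝ) : ℂ) * conj (eisCT y r) := by
  unfold eisCoeff
  have hua : IsAutomorphic Γℤ (fun w => conj (eisensteinCrit w r)) := fun γ hγ z => by
    simp [isAutomorphic_eisensteinCrit r γ hγ z]
  have hcont : Continuous fun w => eisensteinCrit w r := (isC2_and_eigen_eisensteinCrit r).1.continuous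
  have hul : LocallyIntegrable fun w => conj (eisensteinCrit w r) :=
    (Complex.continuous_conj.comp hcont).locallyIntegrable
  have e1 : ∫ w in ModularGroup.fd, ((incEisG ψ w : ℝ) : ℂ) * conj (eisensteinCrit w r) =
      ∫ w in ModularGroup.fd, conj (eisensteinCrit w r) * ((incEisG ψ w : ℝ) : ℂ) := by
    congr 1; funext w; ring
  rw [e1, setIntegral_fd_mul_incEisG hψ hua hul]
  congr 1
  refine setIntegral_congr_fun measurableSet_Ioi fun y hy => ?_
  have hy' : (0 : ℝ) < y := hy
  rw [integral_conj, integral_Ico_eq_integral_Ioc, ← intervalIntegral.integral_of_le zero_le_one,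
    intervalIntegral_eisensteinCrit hy']

/-- `conj (y^s) = y^{s̄}` for real `y ≥ 0`. [folklore] -/
theorem conj_ofReal_cpow {y : ℝ} (hy : 0 ≤ y) (s : ℂ) : conj (((y : ℝ) : ℂ) ^ s) = ((y : ℝ) : ℂ) ^ (conj s) := by
  have harg : ((y : ℂ)).arg ≠ π := by
    rw [Complex.arg_ofReal_of_nonneg hy]; exact Real.pi_ne_zero.symm
  have h := Complex.conj_cpow (y : ℂ) s harg
  rw [Complex.conj_ofReal] at h
  rw [h, Complex.conj_conj]

/-- `∫₀^∞ y⁻² ψ(y) y^{w} dy = Mψ(w - 1)`, `Mψ = mellin ψ`. [folklore] -/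
theorem integral_inv_sq_mul_cpow (ψ : ℝ → ℝ) (w : ℂ) :
    ∫ y in Ioi (0 : ℝ), (((y ^ 2)⁻¹ * ψ y : ℝ) : ℂ) * ((y : ℝ) : ℂ) ^ w = mellin (fun v => ((ψ v : ℝ) : ℂ)) (w - 1) := by
  rw [mellin]
  refine setIntegral_congr_fun measurableSet_Ioi fun y hy => ?_
  have hy' : (0 : ℝ) < y := hy
  have hyc : ((y : ℝ) : ℂ) ≠ 0 := by exact_mod_cast hy'.ne'
  rw [smul_eq_mul, show w - 1 - 1 = w + (-2 : ℂ) by ring, Complex.cpow_add _ _ hyc]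
  have e : ((y : ℝ) : ℂ) ^ (-2 : ℂ) = (((y ^ 2)⁻¹ : ℝ) : ℂ) := by
    rw [show (-2 : ℂ) = ((-2 : ℤ) : ℂ) by norm_num, Complex.cpow_intCast]
    push_cast
    rw [zpow_neg, zpow_ofNat]
  rw [e]
  push_cast
  ring

/-- **The Eisenstein coefficient of an incomplete Eisenstein series** (Iwaniec's formula before (7.14),
for `Γ = SL₂(ℤ)` on the critical line): for every real `r`,
`⟨E(·|ψ), E(·, ½+ir)⟩ = 2[Mψ(-½ - ir) + conj φ(½ + ir) · Mψ(-½ + ir)]`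
(at `r = 0` both sides vanish: `E(·, ½) ≡ 0` and `φ(½) = -1`). [cite: Iwaniec2002, §7.3 (before (7.14)), PDF p. 99] -/
theorem eisCoeff_eq (hψ : IsBumpWeight ψ) (r : ℝ) :
    eisCoeff ψ r = 2 * (mellin (fun v => ((ψ v : ℝ) : ℂ)) (critS (-r) - 1) +
      conj (scatPhi (critS r)) * mellin (fun v => ((ψ v : ℝ) : ℂ)) (critS r - 1)) := by
  rw [eisCoeff_eq_integral hψ]
  by_cases hr : r = 0
  · subst hr
    have h0 : critS 0 = 1 / 2 := by simp [critS]
    simp only [eisCT_zero, map_zero, mul_zero, neg_zero, h0, scatPhi_half, map_neg, map_one]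
    rw [integral_zero]
    ring
  congr 1
  have e : ∀ y ∈ Ioi (0 : ℝ), (((y ^ 2)⁻¹ * ψ y : ℝ) : ℂ) * conj (eisCT y r) =
      (((y ^ 2)⁻¹ * ψ y : ℝ) : ℂ) * ((y : ℝ) : ℂ) ^ (critS (-r)) +
        conj (scatPhi (critS r)) * ((((y ^ 2)⁻¹ * ψ y : ℝ) : ℂ) * ((y : ℝ) : ℂ) ^ (critS r)) := by
    intro y hy
    have hy' : (0 : ℝ) < y := hy
    rw [eisCT_eq hr, map_add, map_mul, conj_ofReal_cpow hy'.le, conj_ofReal_cpow hy'.le, conj_critS,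
      show conj (1 - critS r) = critS r by rw [map_sub, map_one, conj_critS, ← one_sub_critS, sub_sub_cancel]]
    ring
  rw [setIntegral_congr_fun measurableSet_Ioi e]
  -- both pieces are integrable (compact support of `ψ` in `(0, ∞)`)
  have hint : ∀ w : ℂ, IntegrableOn (fun y : ℝ => (((y ^ 2)⁻¹ * ψ y : ℝ) : ℂ) * ((y : ℝ) : ℂ) ^ w) (Ioi 0) := by
    intro w
    have hG : ContinuousOn (fun y : ℝ => (((y ^ 2)⁻¹ : ℝ) : ℂ) * ((y : ℝ) : ℂ) ^ w) (Ioi 0) := by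
      intro y hy
      have hy' : (0 : ℝ) < y := hy
      refine ContinuousAt.continuousWithinAt (ContinuousAt.mul ?_ ?_)
      · exact Complex.continuous_ofReal.continuousAt.comp ((continuousAt_id.pow 2).inv₀ (by simp [hy'.ne']))
      · exact Complex.continuousAt_ofReal_cpow_const y w (Or.inr hy'.ne')
    refine (hψ.integrableOn_mul hG).congr_fun (fun y _ => ?_) measurableSet_Ioi
    push_cast; ring
  rw [integral_add (hint _) ((hint _).const_mul _), integral_const_mul, integral_inv_sq_mul_cpow,
    integral_inv_sq_mul_cpow]

end EisCoeff

end Literature.NumberTheory.Automorphic
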